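import Literature.MathematicalPhysics.QuantumFieldTheory.Balaban1983to89.B3Eq121FirstBlock

/-!
# `Balaban1983to89.B3Eq121LabelledChains` — T. Bałaban, *(Higgs)₂,₃ quantum fields in a finite volume. III.
# Renormalization*, Commun. Math. Phys. **88** (1983) 411–445 [Balaban1983Higgs3], (1.21) p. 416 — THE LABELLED
# LAST-BLOCK RECURSION `𝔸(U) = 𝕂(U) + Σ_{B ⊆ U} 𝔸(U∖B)·C₀·𝕂(B)` FOR THE AMPUTATED CONNECTED TWO-POINT MATRICES
# (BRICK 9, FILE 2 of «amputation / 1PI / Dyson resummation FROM (1.19)» on the labelled carrier of BRICK 5)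

statement-level skeleton of published theorems with citation tags; proofs where landed; nothing here is a claim about
the Yang–Mills mass gap

PDF held: `paper:balaban1983-higgs-2-3-quantum-fields-finite-volume` (journal page = PDF page + 410); p. 416 (PDF 6) L12–21 and
p. 414 (PDF 4) L38–43 read in the text layer this session.

CITATION HEADER (lean-in-tree rule).  Part of the lit-balaban TYPED SKELETON (HOME `run/shared/lean/pub/lit-balaban/`),
Phase 2, proof seat p33 (gen 73, unit `lit-balaban-p33`; TAKING HOME/STATUS.md 2026-08-23T17:00:23Z, owner r15 g16 «WELCOME —
PRIORITY YOURS» 17:02:01Z); row **B3.Eq1.19-1.22** of `HOME/lit-balaban-r15/ROWS-B3.md` (fold owner r15, referee ref-4; head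
`proved`, HEAD WORDS Q25/Q28/Q28′ — this file is an OPTIONAL located member, zero head weight).  WHAT IS REPRODUCED: the
second step of «amputation / 1PI / Dyson resummation FROM (1.19)» (the element of the row's v1.330 scope clause named as NOT
in the tree): from FILE 1's first-block recursion for ONE colouring (`B3Eq121FirstBlock.ampSum_eq_kerSum_add`) to the
COLOUR-SUMMED, POSITION-INDEXED matrix recursion in the LAST-block form of r15's `B3Sect1TwoPoint.Eq121` (`G = C₀ + G·X·C₀`).
FILE 3 (next): relabelling to `Fin m`, the binomial convolution, the exponential generating function and `Eq121`/p32's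
`greenSeries`/`dysonTerm` BY NAME; FILE 4: the instance on BRICK 5's `HiggsLattice` carrier at `e = 0`.  USED BY NAME, nothing
re-declared: FILE 1 (`legsOf`, `IsPM`/`pmatchings`, `crossInd`, `cut`, `IsAmp`, `Conn`, `OnePI`, `exitPairs`, `even_cut`,
`card_inter_add_card_inter`, `legs_disjoint`, `ampSet`/`kerSet`/`ampSum`/`kerSum`, `ampSum_eq_kerSum_add`), p13's
`IsSetPartition.map`/`setPartitions_map` (`HardCoreUrsell`), Mathlib's `Finset.sum_comm'`, `Fin.card_filter_val_lt`,
`Set.pair_eq_pair_iff`.  DISJOINT from p32/p37's model-graph chain files (nothing imported, no dictionary claimed).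

THE PRINT (verbatim, p. 416): «The function G^ε has a perturbative expansion of the following structure
G^ε = Σ_{n=0}^∞ C^ε_0[(−δm² + Σ^ε + ∂^{ε*}Σ^ε_1 + Σ^{ε*}_1∂^ε + ∂^{ε*}Σ^ε_2∂^ε)C^ε_0]ⁿ, (1.21) where C^ε_0 = (−Δ^ε_0 + m²)^{−1} and
Σ^ε, Σ^ε_1, Σ^ε_2 are given by amputated, one-particle-irreducible graphs of the expansion of G^ε. Here we have a graphical
description of the same type as in (1.17) … (of course internal indices and vector indices are understood here).»

THE ARGUMENT (ours).  §1 SYMMETRY: under even degrees the notions of FILE 1 do not depend on which external point is the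
entry — `cut` is symmetric (`cut_comm`), `Conn_a ⇔ Conn_e` (`conn_comm`: a vertex set containing the entry vertex but not the
exit vertex is left by an odd number of lines, `exists_cross_of_mem_of_notMem`), `OnePI(a,e) ⇔ OnePI(e,a)` (`onePI_comm`: a
block `S ∋ own e` of cut count 2 not containing `own a` has complement `U ∖ S ∋ own a` of cut count 2, `crossInd_compl`);
hence FILE 1's first-block recursion read from the exit gives the LAST-BLOCK RECURSION `ampSum_eq_kerSum_add_last`:
`𝒜_U(a,e) = K_U(a,e) + Σ_{B ∋ own e, ∌ own a} Σ_{a₂ ∈ L_{U∖B}∖{a}} Σ_{e₁ ∈ L_B∖{e}} 𝒜_{U∖B}(a,a₂)·w{a₂,e₁}·K_B(e₁,e)`.  §2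
LOCALITY (`ampSum_congr`, `kerSum_congr`): the sums on `U` depend only on the active legs owned in `U` and their pair weights.
§3 TRANSPORT along embeddings of legs and vertices (`legsOf_map`, `pmatchings_map`, `cut_map`, `conn_map_iff`, `onePI_map_iff`,
`ampSet_map`, `ampSum_map`, `kerSum_map`).  §4 MATRIX FORM: legs carry positions `pos : Λ → S` (site × internal index) and the
pair weight is a propagator `w{l,l′} = C(pos l, pos l′)` (`hw`); `posVec`/`posMat` sum leg quantities by position
(`posMat_mul_mul_posMat` evaluates `posMat·C·posMat`); the AMPUTATED CONNECTED / 1PI MATRICES `ampMat U`, `kerMat U`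
(`Matrix S S R`: entry leg at `p`, exit leg at `q`) satisfy `ampMat_eq`: `𝒜_U = K_U + Σ_{B ⊆ U} 𝒜_{U∖B}·C·K_B` (`rowA_eq`: two
`Finset.sum_comm'` exchanges turn «Σ_e Σ_{B ∋ own e}» into «Σ_B Σ_{e ∈ L_B}» and «Σ_{e} Σ_{e₁ ≠ e}» into «Σ_{e₁} Σ_{e ≠ e₁}»;
the empty and the full block contribute 0), plus locality/transport of the matrices (`ampMat_congr`, `ampMat_map`).  §5
COLOURINGS: `pw C pos` = the pair weight of a (symmetric) propagator (`pw_pair`, `pw_congr`, `pw_map`); `VertexData` = vertex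
colours `Kv` (types × sites × indices), spare colour `c₀`, even degrees `deg ≤ D`, leg positions `lpos`, coefficients `coef`; a
colouring `z : W → κ` of the vertex type `W` has active legs `act z ⊆ W × Fin D` and positions `lposOf z`; `col U` = colourings
with vertex colours on `U` and `c₀` elsewhere; `𝔸(U) = Σ_{z ∈ col U} (Π_{v∈U} coef z_v)·𝒜_z(U)` (`AMat`), `𝕂(U)` (`KMat`); the
colourings of `U` are pairs (colouring of `B`, colouring of `U ∖ B`) (`merge`/`restrict`, a `Finset.sum_nbij'`), the
per-colouring matrices of a block see only the block's colours (`ampMatZ_congr`), so `sum_col_merge`: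
`Σ_z coef·𝒜_z(U∖B)·C·K_z(B) = 𝔸(U∖B)·C·𝕂(B)`, and the headline **`AMat_eq`**: `𝔸(U) = 𝕂(U) + Σ_{B ⊆ U} 𝔸(U∖B)·C·𝕂(B)`.

WHAT IS PROVED (0 `sorry`, no `Prop` fact; standard axioms).
* §1 `cut_comm`, `isAmp_symm`, `exists_cross_of_mem_of_notMem`, **`conn_symm`/`conn_comm`**, `crossInd_compl`,
  **`onePI_symm`/`onePI_comm`**, `ampSum_comm`, `kerSum_comm`, **`ampSum_eq_kerSum_add_last`**.
* §2 `legsOf_congr`, `conn_congr`, `onePI_congr`, **`ampSum_congr`**, `kerSum_congr`.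
* §3 `legsOf_map`, `crossInd_map`, `cut_map`, `isPM_map_iff`, `pmatchings_map`, `conn_map_iff`, `onePI_map_iff`, `map_sdiff_pair`,
  `ampSet_map`, `kerSet_map`, **`ampSum_map`**, `kerSum_map`.
* §4 `posVec`, `posMat`, `sum_ite_pos_eq`, `posMat_mul_apply`, `sum_posVec_mul`, `mul_posMat_apply`, **`posMat_mul_mul_posMat`**;
  `ampMat`, `kerMat`, **`rowA_eq`**, **`ampMat_eq`**, `ampMat_congr`, `kerMat_congr`, `ampMat_map`, `kerMat_map`.
* §5 `pw`, `pw_congr`, `pw_pair`, `pw_of_card_ne_two`, `pw_map`; `VertexData` (`act`, `lposOf`, `col`, `coefOf`, `merge`, `restrict`,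
  `mem_col`, `card_act_fiber`, **`even_deg_of_mem_col`**, `merge_mem_col`, `restrict_mem_col`), `ampMatZ`, `kerMatZ`, **`AMat`**,
  **`KMat`**, `ampMatZ_congr`, `kerMatZ_congr`, `coefOf_congr`, **`sum_col_merge`**, and the headline **`AMat_eq`**.
HONEST SCOPE.  (i) Still pure finite algebra/combinatorics over a commutative ring of scalars; `C` is any SYMMETRIC matrix on
the position type (print's `C₀^ε` is symmetric; vector lines are another position block of the same device).  (ii) The
recursion is indexed by vertex SUBSETS; that `𝕂(B)` depends on `|B|` only, the binomial convolution, the `1/n!` and the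
formal power series (1.21) are FILE 3.  (iii) Even degrees are built into `VertexData` (vertex colours), as in FILE 1.
(iv) No symmetry factors (labelled), no estimates, nothing about `ε → 0`.
-/

namespace Literature.MathematicalPhysics.QuantumFieldTheory.Balaban1983to89.B3Eq121LabelledChains

open Finset Literature.Probability.LatticeModels B3Eq121FirstBlock

variable {Λ : Type*} [DecidableEq Λ] {V : Type*} [DecidableEq V]

/-! ## §1 Entry/exit symmetry and the LAST-block recursion -/

section Symmetry

variable {own : Λ → V} {A : Finset Λ} {U : Finset V} {a e : Λ} {μ : Finset (Finset Λ)}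

/-- kernel: the cut count is symmetric in the entry and exit legs. [cite: Balaban1983Higgs3, (1.21) p.416] -/
theorem cut_comm (μ : Finset (Finset Λ)) (a e : Λ) (T : Finset Λ) : cut μ a e T = cut μ e a T := by
  unfold cut; ring

/-- kernel: `(e, a, μ)` is an amputated pairing iff `(a, e, μ)` is. [cite: Balaban1983Higgs3, (1.21) p.416] -/
theorem isAmp_symm (h : IsAmp own A U a e μ) : IsAmp own A U e a μ :=
  ⟨h.he, h.ha, h.ne.symm, by rw [pair_comm]; exact h.pm⟩

/-- kernel: under even degrees, a vertex set containing the entry vertex but not the exit vertex is left by a pair of `μ`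
(parity: its cut count is even and the entry line contributes one). [cite: Balaban1983Higgs3, (1.21) p.416] -/
theorem exists_cross_of_mem_of_notMem (h : IsAmp own A U a e μ) (hdeg : ∀ v ∈ U, Even (A.filter fun l => own l = v).card)
    {S : Finset V} (hS : S ⊆ U) (haS : own a ∈ S) (heS : own e ∉ S) :
    ∃ P ∈ μ, (P ∩ legsOf own A S).card = 1 := by
  have hev := even_cut h hdeg hS
  have haL : a ∈ legsOf own A S := (mem_legsOf own A).2 ⟨((mem_legsOf own A).1 h.ha).1, haS⟩
  have heL : e ∉ legsOf own A S := fun h' => heS ((mem_legsOf own A).1 h').2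
  rw [cut, sum_crossInd_eq_card, if_pos haL, if_neg heL] at hev
  have hpos : 0 < (exitPairs μ (legsOf own A S)).card := by
    rcases Nat.even_or_odd (exitPairs μ (legsOf own A S)).card with h' | h'
    · exfalso; obtain ⟨k, hk⟩ := h'; obtain ⟨m, hm⟩ := hev; omega
    · exact h'.pos
  obtain ⟨P, hP⟩ := card_pos.1 hpos
  exact ⟨P, (mem_exitPairs.1 hP).1, (mem_exitPairs.1 hP).2⟩

/-- **Connectedness does not depend on which external point is called the entry** (under even degrees).
[cite: Balaban1983Higgs3, p.415] -/
theorem conn_symm (h : IsAmp own A U a e μ) (hdeg : ∀ v ∈ U, Even (A.filter fun l => own l = v).card)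
    (hc : Conn own A U a μ) : Conn own A U e μ := by
  intro S hS hne heS
  by_cases haS : own a ∈ S
  · exact exists_cross_of_mem_of_notMem h hdeg (mem_powerset.1 hS) haS heS
  · exact hc S hS hne haS

/-- kernel: `Conn` for entry `a` iff for entry `e`. [cite: Balaban1983Higgs3, p.415] -/
theorem conn_comm (h : IsAmp own A U a e μ) (hdeg : ∀ v ∈ U, Even (A.filter fun l => own l = v).card) :
    Conn own A U a μ ↔ Conn own A U e μ :=
  ⟨conn_symm h hdeg, conn_symm (isAmp_symm h) hdeg⟩

/-- kernel: a pair of legs of `U` crosses `L_S` iff it crosses `L_{U∖S}`. [cite: Balaban1983Higgs3, (1.21) p.416] -/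
theorem crossInd_compl {P : Finset Λ} (hP : P ⊆ legsOf own A U) (hP2 : P.card = 2) {S : Finset V} (hS : S ⊆ U) :
    crossInd (legsOf own A S) P = crossInd (legsOf own A (U \ S)) P := by
  have hsum := card_inter_add_card_inter (B := S) hP hS
  rw [hP2] at hsum
  unfold crossInd
  by_cases h1 : (P ∩ legsOf own A S).card = 1
  · rw [if_pos h1, if_pos (by omega)]
  · rw [if_neg h1, if_neg (by omega)]

/-- **One-particle irreducibility is symmetric in the two external points** (under even degrees).
[cite: Balaban1983Higgs3, (1.21) p.416] -/
theorem onePI_symm (h : IsAmp own A U a e μ) (hdeg : ∀ v ∈ U, Even (A.filter fun l => own l = v).card)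
    (h1 : OnePI own A U a e μ) : OnePI own A U e a μ := by
  refine ⟨conn_symm h hdeg h1.1, fun S hS heS hcS => ?_⟩
  have hSU := mem_powerset.1 hS
  by_cases haS : own a ∈ S
  · exact h1.2 S hS haS (by rw [cut_comm]; exact hcS)
  · exfalso
    -- the complement would be a proper block of cut count 2 containing the entry vertex
    have haU : own a ∈ U := ((mem_legsOf own A).1 h.ha).2
    have haT : own a ∈ U \ S := mem_sdiff.2 ⟨haU, haS⟩
    have haL : a ∈ legsOf own A (U \ S) := (mem_legsOf own A).2 ⟨((mem_legsOf own A).1 h.ha).1, haT⟩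
    have heL : e ∉ legsOf own A (U \ S) := fun h' => (mem_sdiff.1 ((mem_legsOf own A).1 h').2).2 heS
    have haL' : a ∉ legsOf own A S := fun h' => haS ((mem_legsOf own A).1 h').2
    have heL' : e ∈ legsOf own A S := (mem_legsOf own A).2 ⟨((mem_legsOf own A).1 h.he).1, heS⟩
    have hsum : ∑ P ∈ μ, crossInd (legsOf own A (U \ S)) P = ∑ P ∈ μ, crossInd (legsOf own A S) P :=
      sum_congr rfl fun P hP => (crossInd_compl ((h.pm.1.subset hP).trans sdiff_subset) (h.pm.2 P hP) hSU).symm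
    have hcT : cut μ a e (legsOf own A (U \ S)) = 2 := by
      unfold cut at hcS ⊢
      rw [hsum, if_pos haL, if_neg heL]
      rw [if_neg haL', if_pos heL'] at hcS
      omega
    have hT := h1.2 (U \ S) (mem_powerset.2 sdiff_subset) haT hcT
    have : own e ∈ U \ S := hT.symm ▸ ((mem_legsOf own A).1 h.he).2
    exact (mem_sdiff.1 this).2 heS

/-- kernel: `OnePI` for `(a, e)` iff for `(e, a)`. [cite: Balaban1983Higgs3, (1.21) p.416] -/
theorem onePI_comm (h : IsAmp own A U a e μ) (hdeg : ∀ v ∈ U, Even (A.filter fun l => own l = v).card) :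
    OnePI own A U a e μ ↔ OnePI own A U e a μ :=
  ⟨onePI_symm h hdeg, onePI_symm (isAmp_symm h) hdeg⟩

variable {R : Type*} [CommRing R] (w : Finset Λ → R)

/-- kernel: the connected sum is symmetric in entry/exit. [cite: Balaban1983Higgs3, (1.21) p.416] -/
theorem ampSum_comm (hdeg : ∀ v ∈ U, Even (A.filter fun l => own l = v).card) (ha : a ∈ legsOf own A U)
    (he : e ∈ legsOf own A U) (hne : a ≠ e) : ampSum own A w U a e = ampSum own A w U e a := by
  unfold ampSum
  refine sum_congr ?_ fun _ _ => rfl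
  ext μ
  rw [mem_ampSet, mem_ampSet, pair_comm]
  constructor
  · rintro ⟨hpm, hc⟩
    exact ⟨hpm, conn_symm ⟨ha, he, hne, by rw [pair_comm]; exact hpm⟩ hdeg hc⟩
  · rintro ⟨hpm, hc⟩
    exact ⟨hpm, conn_symm ⟨he, ha, hne.symm, hpm⟩ hdeg hc⟩

/-- kernel: the 1PI sum is symmetric in entry/exit. [cite: Balaban1983Higgs3, (1.21) p.416] -/
theorem kerSum_comm (hdeg : ∀ v ∈ U, Even (A.filter fun l => own l = v).card) (ha : a ∈ legsOf own A U)
    (he : e ∈ legsOf own A U) (hne : a ≠ e) : kerSum own A w U a e = kerSum own A w U e a := by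
  unfold kerSum
  refine sum_congr ?_ fun _ _ => rfl
  ext μ
  rw [mem_kerSet, mem_kerSet, pair_comm]
  constructor
  · rintro ⟨hpm, hc⟩
    exact ⟨hpm, onePI_symm ⟨ha, he, hne, by rw [pair_comm]; exact hpm⟩ hdeg hc⟩
  · rintro ⟨hpm, hc⟩
    exact ⟨hpm, onePI_symm ⟨he, ha, hne.symm, hpm⟩ hdeg hc⟩

/-- **THE LAST-BLOCK RECURSION**: `𝒜_U(a, e) = K_U(a, e) + Σ_{B ∋ own e, B ∌ own a} Σ_{a₂ ∈ L_{U∖B}∖{a}} Σ_{e₁ ∈ L_B∖{e}}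
𝒜_{U∖B}(a, a₂) · w{a₂, e₁} · K_B(e₁, e)` (a connected amputated two-point graph read from `x` is a connected part, one line,
and a LAST one-particle-irreducible piece — the form `G = C₀ + G·X·C₀` of r15's `Eq121`). [cite: Balaban1983Higgs3, (1.21) p.416] -/
theorem ampSum_eq_kerSum_add_last (hdeg : ∀ v ∈ U, Even (A.filter fun l => own l = v).card) (ha : a ∈ legsOf own A U)
    (he : e ∈ legsOf own A U) (hne : a ≠ e) :
    ampSum own A w U a e = kerSum own A w U a e +
      ∑ B ∈ U.powerset.filter (fun B => own e ∈ B ∧ own a ∉ B), ∑ a₂ ∈ (legsOf own A (U \ B)).erase a,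
        ∑ e₁ ∈ (legsOf own A B).erase e,
          ampSum own A w (U \ B) a a₂ * w {a₂, e₁} * kerSum own A w B e₁ e := by
  rw [ampSum_comm w hdeg ha he hne, kerSum_comm w hdeg ha he hne, ampSum_eq_kerSum_add w hdeg he ha hne.symm]
  congr 1
  refine sum_congr rfl fun B hB => ?_
  obtain ⟨hBU, heB, haB⟩ := by simpa only [mem_filter, mem_powerset] using hB
  rw [sum_comm]
  refine sum_congr rfl fun a₂ ha₂ => sum_congr rfl fun e₁ he₁ => ?_
  obtain ⟨ha₂a, ha₂⟩ := mem_erase.1 ha₂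
  obtain ⟨he₁e, he₁⟩ := mem_erase.1 he₁
  have hdegB : ∀ v ∈ B, Even (A.filter fun l => own l = v).card := fun v hv => hdeg v (hBU hv)
  have hdegC : ∀ v ∈ U \ B, Even (A.filter fun l => own l = v).card := fun v hv => hdeg v (sdiff_subset hv)
  have heLB : e ∈ legsOf own A B := (mem_legsOf own A).2 ⟨((mem_legsOf own A).1 he).1, heB⟩
  have haLC : a ∈ legsOf own A (U \ B) :=
    (mem_legsOf own A).2 ⟨((mem_legsOf own A).1 ha).1, mem_sdiff.2 ⟨((mem_legsOf own A).1 ha).2, haB⟩⟩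
  rw [kerSum_comm w hdegB heLB he₁ he₁e.symm, ampSum_comm w hdegC ha₂ haLC ha₂a, pair_comm]
  ring

end Symmetry

/-! ## §2 Locality: the sums depend on the active legs and weights of `U` only -/

section Congr

variable {own : Λ → V} {A A' : Finset Λ} {U : Finset V} {R : Type*} [CommRing R] {w w' : Finset Λ → R}

omit [DecidableEq Λ] in
/-- kernel: leg sets inside `U` agree when the active sets agree on the legs owned in `U`. [cite: Balaban1983Higgs3, (1.21) p.416] -/
theorem legsOf_congr (hA : ∀ l, own l ∈ U → (l ∈ A ↔ l ∈ A')) {S : Finset V} (hS : S ⊆ U) :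
    legsOf own A S = legsOf own A' S := by
  ext l
  simp only [mem_legsOf]
  constructor
  · rintro ⟨h1, h2⟩; exact ⟨(hA l (hS h2)).1 h1, h2⟩
  · rintro ⟨h1, h2⟩; exact ⟨(hA l (hS h2)).2 h1, h2⟩

/-- kernel: `Conn` depends on the active legs of `U` only. [cite: Balaban1983Higgs3, p.415] -/
theorem conn_congr (hA : ∀ l, own l ∈ U → (l ∈ A ↔ l ∈ A')) (a : Λ) (μ : Finset (Finset Λ)) :
    Conn own A U a μ ↔ Conn own A' U a μ := by
  unfold Conn
  refine forall₂_congr fun S hS => ?_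
  rw [legsOf_congr hA (mem_powerset.1 hS)]

/-- kernel: `OnePI` depends on the active legs of `U` only. [cite: Balaban1983Higgs3, (1.21) p.416] -/
theorem onePI_congr (hA : ∀ l, own l ∈ U → (l ∈ A ↔ l ∈ A')) (a e : Λ) (μ : Finset (Finset Λ)) :
    OnePI own A U a e μ ↔ OnePI own A' U a e μ := by
  unfold OnePI
  rw [conn_congr hA]
  refine and_congr_right fun _ => forall₂_congr fun S hS => ?_
  rw [legsOf_congr hA (mem_powerset.1 hS)]

/-- **Locality of `𝒜`**: the connected sum on `U` depends only on the active legs owned in `U` and on the weights of pairs of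
such legs. [cite: Balaban1983Higgs3, (1.21) p.416] -/
theorem ampSum_congr (hA : ∀ l, own l ∈ U → (l ∈ A ↔ l ∈ A')) (hw : ∀ P, P ⊆ legsOf own A U → w P = w' P) (a e : Λ) :
    ampSum own A w U a e = ampSum own A' w' U a e := by
  unfold ampSum
  have hset : ampSet own A U a e = ampSet own A' U a e := by
    ext μ; rw [mem_ampSet, mem_ampSet, legsOf_congr hA Subset.rfl, conn_congr hA]
  rw [← hset]
  refine sum_congr rfl fun μ hμ => prod_congr rfl fun P hP => hw P ?_
  exact ((mem_ampSet.1 hμ).1.1.subset hP).trans sdiff_subset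

/-- **Locality of `K`**. [cite: Balaban1983Higgs3, (1.21) p.416] -/
theorem kerSum_congr (hA : ∀ l, own l ∈ U → (l ∈ A ↔ l ∈ A')) (hw : ∀ P, P ⊆ legsOf own A U → w P = w' P) (a e : Λ) :
    kerSum own A w U a e = kerSum own A' w' U a e := by
  unfold kerSum
  have hset : kerSet own A U a e = kerSet own A' U a e := by
    ext μ; rw [mem_kerSet, mem_kerSet, legsOf_congr hA Subset.rfl, onePI_congr hA]
  rw [← hset]
  refine sum_congr rfl fun μ hμ => prod_congr rfl fun P hP => hw P ?_
  exact ((mem_kerSet.1 hμ).1.1.subset hP).trans sdiff_subset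

end Congr

/-! ## §3 Transport along a relabelling of legs and vertices -/

section Transport

variable {Λ' : Type*} [DecidableEq Λ'] {V' : Type*} [DecidableEq V']
variable {own : Λ → V} {own' : Λ' → V'} (eΛ : Λ ↪ Λ') (eV : V ↪ V') (hown : ∀ l, own' (eΛ l) = eV (own l))
variable (A : Finset Λ)
include hown

omit [DecidableEq Λ] [DecidableEq Λ'] in
/-- kernel: leg sets transport. [cite: Balaban1983Higgs3, (1.21) p.416] -/
theorem legsOf_map (S : Finset V) : legsOf own' (A.map eΛ) (S.map eV) = (legsOf own A S).map eΛ := by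
  ext l'
  simp only [mem_legsOf, mem_map]
  constructor
  · rintro ⟨⟨l, hl, rfl⟩, ⟨v, hv, hv'⟩⟩
    rw [hown] at hv'
    exact ⟨l, ⟨hl, by rwa [← eV.injective hv']⟩, rfl⟩
  · rintro ⟨l, ⟨hl, hv⟩, rfl⟩
    exact ⟨⟨l, hl, rfl⟩, ⟨own l, hv, (hown l).symm⟩⟩

omit hown in
/-- kernel: crossing indicators transport. [cite: Balaban1983Higgs3, (1.21) p.416] -/
theorem crossInd_map (T P : Finset Λ) : crossInd (T.map eΛ) (P.map eΛ) = crossInd T P := by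
  unfold crossInd
  rw [← map_inter, card_map]

omit hown in
/-- kernel: cut counts transport. [cite: Balaban1983Higgs3, (1.21) p.416] -/
theorem cut_map (μ : Finset (Finset Λ)) (a e : Λ) (T : Finset Λ) :
    cut (μ.map (mapEmbedding eΛ).toEmbedding) (eΛ a) (eΛ e) (T.map eΛ) = cut μ a e T := by
  have h1 : ∑ x ∈ μ, crossInd (T.map eΛ) ((mapEmbedding eΛ).toEmbedding x) = ∑ P ∈ μ, crossInd T P :=
    sum_congr rfl fun P _ => by rw [RelEmbedding.coe_toEmbedding, mapEmbedding_apply]; exact crossInd_map eΛ T P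
  unfold cut
  rw [sum_map, h1]
  simp only [mem_map']

omit hown in
/-- kernel: perfect matchings transport. [cite: Balaban1983Higgs3, p.414] -/
theorem isPM_map_iff {X : Finset Λ} {μ : Finset (Finset Λ)} :
    IsPM (X.map eΛ) (μ.map (mapEmbedding eΛ).toEmbedding) ↔ IsPM X μ := by
  constructor
  · rintro ⟨h1, h2⟩
    have hmem : μ.map (mapEmbedding eΛ).toEmbedding ∈ setPartitions (X.map eΛ) := mem_setPartitions.2 h1
    rw [setPartitions_map, mem_map] at hmem
    obtain ⟨ν, hν, hνμ⟩ := hmem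
    rw [RelEmbedding.coe_toEmbedding, mapEmbedding_apply] at hνμ
    have hνμ' : ν = μ := map_injective _ hνμ
    subst hνμ'
    refine ⟨mem_setPartitions.1 hν, fun P hP => ?_⟩
    have := h2 (P.map eΛ) (mem_map_of_mem _ hP)
    rwa [card_map] at this
  · rintro ⟨h1, h2⟩
    refine ⟨h1.map eΛ, fun P' hP' => ?_⟩
    obtain ⟨P, hP, rfl⟩ := mem_map.1 hP'
    rw [RelEmbedding.coe_toEmbedding, mapEmbedding_apply, card_map]
    exact h2 P hP

omit hown in
/-- kernel: the finset of perfect matchings transports. [cite: Balaban1983Higgs3, p.414] -/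
theorem pmatchings_map (X : Finset Λ) :
    pmatchings (X.map eΛ) = (pmatchings X).map (mapEmbedding (mapEmbedding eΛ).toEmbedding).toEmbedding := by
  ext μ'
  rw [mem_pmatchings, mem_map]
  constructor
  · intro h
    have hmem : μ' ∈ setPartitions (X.map eΛ) := mem_setPartitions.2 h.1
    rw [setPartitions_map, mem_map] at hmem
    obtain ⟨μ, -, rfl⟩ := hmem
    exact ⟨μ, mem_pmatchings.2 ((isPM_map_iff eΛ).1 h), rfl⟩
  · rintro ⟨μ, hμ, rfl⟩
    exact (isPM_map_iff eΛ).2 (mem_pmatchings.1 hμ)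

/-- kernel: connectedness transports. [cite: Balaban1983Higgs3, p.415] -/
theorem conn_map_iff (U : Finset V) (a : Λ) (μ : Finset (Finset Λ)) :
    Conn own' (A.map eΛ) (U.map eV) (eΛ a) (μ.map (mapEmbedding eΛ).toEmbedding) ↔ Conn own A U a μ := by
  constructor
  · intro hc S hS hne haS
    have hS' : S.map eV ∈ (U.map eV).powerset := mem_powerset.2 (map_subset_map.2 (mem_powerset.1 hS))
    have haS' : own' (eΛ a) ∉ S.map eV := by rw [hown, mem_map' eV]; exact haS
    obtain ⟨P', hP', hc'⟩ := hc _ hS' (hne.map) haS'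
    obtain ⟨P, hP, rfl⟩ := mem_map.1 hP'
    refine ⟨P, hP, ?_⟩
    rwa [RelEmbedding.coe_toEmbedding, mapEmbedding_apply, legsOf_map eΛ eV hown, ← map_inter, card_map] at hc'
  · intro hc S' hS' hne' haS'
    obtain ⟨S, hS, rfl⟩ := subset_map_iff.1 (mem_powerset.1 hS')
    have haS : own a ∉ S := fun h => haS' (by rw [hown]; exact mem_map_of_mem _ h)
    have hne : S.Nonempty := by
      obtain ⟨v', hv'⟩ := hne'
      obtain ⟨v, hv, -⟩ := mem_map.1 hv'
      exact ⟨v, hv⟩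
    obtain ⟨P, hP, hcP⟩ := hc S (mem_powerset.2 hS) hne haS
    refine ⟨P.map eΛ, mem_map.2 ⟨P, hP, rfl⟩, ?_⟩
    rw [legsOf_map eΛ eV hown, ← map_inter, card_map]
    exact hcP

/-- kernel: one-particle irreducibility transports. [cite: Balaban1983Higgs3, (1.21) p.416] -/
theorem onePI_map_iff (U : Finset V) (a e : Λ) (μ : Finset (Finset Λ)) :
    OnePI own' (A.map eΛ) (U.map eV) (eΛ a) (eΛ e) (μ.map (mapEmbedding eΛ).toEmbedding) ↔ OnePI own A U a e μ := by
  unfold OnePI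
  rw [conn_map_iff eΛ eV hown]
  refine and_congr_right fun _ => ?_
  constructor
  · intro h S hS haS hcS
    have hS' : S.map eV ∈ (U.map eV).powerset := mem_powerset.2 (map_subset_map.2 (mem_powerset.1 hS))
    have haS' : own' (eΛ a) ∈ S.map eV := by rw [hown]; exact mem_map_of_mem _ haS
    have hcS' : cut (μ.map (mapEmbedding eΛ).toEmbedding) (eΛ a) (eΛ e) (legsOf own' (A.map eΛ) (S.map eV)) = 2 := by
      rw [legsOf_map eΛ eV hown, cut_map]; exact hcS
    exact (map_inj (f := eV)).1 (h _ hS' haS' hcS')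
  · intro h S' hS' haS' hcS'
    obtain ⟨S, hS, rfl⟩ := subset_map_iff.1 (mem_powerset.1 hS')
    have haS : own a ∈ S := by rw [hown, mem_map' eV] at haS'; exact haS'
    rw [legsOf_map eΛ eV hown, cut_map] at hcS'
    rw [h S (mem_powerset.2 hS) haS hcS']

omit hown in
/-- kernel: the image of `L ∖ {a, e}`. [cite: Balaban1983Higgs3, (1.21) p.416] -/
theorem map_sdiff_pair (L : Finset Λ) (a e : Λ) : (L \ {a, e}).map eΛ = L.map eΛ \ {eΛ a, eΛ e} := by
  rw [Finset.map_sdiff, map_insert, map_singleton]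

variable {R : Type*} [CommRing R] {w : Finset Λ → R} {w' : Finset Λ' → R}

/-- kernel: the connected pairings transport. [cite: Balaban1983Higgs3, (1.21) p.416] -/
theorem ampSet_map (U : Finset V) (a e : Λ) :
    ampSet own' (A.map eΛ) (U.map eV) (eΛ a) (eΛ e)
      = (ampSet own A U a e).map (mapEmbedding (mapEmbedding eΛ).toEmbedding).toEmbedding := by
  ext μ'
  rw [mem_ampSet, mem_map, legsOf_map eΛ eV hown, ← map_sdiff_pair, ]
  constructor
  · rintro ⟨hpm, hc⟩
    have hmem : μ' ∈ pmatchings ((legsOf own A U \ {a, e}).map eΛ) := mem_pmatchings.2 hpm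
    rw [pmatchings_map, mem_map] at hmem
    obtain ⟨μ, hμ, rfl⟩ := hmem
    refine ⟨μ, mem_ampSet.2 ⟨mem_pmatchings.1 hμ, ?_⟩, rfl⟩
    exact (conn_map_iff eΛ eV hown A U a μ).1 hc
  · rintro ⟨μ, hμ, rfl⟩
    obtain ⟨hpm, hc⟩ := mem_ampSet.1 hμ
    exact ⟨(isPM_map_iff eΛ).2 hpm, (conn_map_iff eΛ eV hown A U a μ).2 hc⟩

/-- kernel: the 1PI pairings transport. [cite: Balaban1983Higgs3, (1.21) p.416] -/
theorem kerSet_map (U : Finset V) (a e : Λ) :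
    kerSet own' (A.map eΛ) (U.map eV) (eΛ a) (eΛ e)
      = (kerSet own A U a e).map (mapEmbedding (mapEmbedding eΛ).toEmbedding).toEmbedding := by
  ext μ'
  rw [mem_kerSet, mem_map, legsOf_map eΛ eV hown, ← map_sdiff_pair]
  constructor
  · rintro ⟨hpm, hc⟩
    have hmem : μ' ∈ pmatchings ((legsOf own A U \ {a, e}).map eΛ) := mem_pmatchings.2 hpm
    rw [pmatchings_map, mem_map] at hmem
    obtain ⟨μ, hμ, rfl⟩ := hmem
    refine ⟨μ, mem_kerSet.2 ⟨mem_pmatchings.1 hμ, ?_⟩, rfl⟩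
    exact (onePI_map_iff eΛ eV hown A U a e μ).1 hc
  · rintro ⟨μ, hμ, rfl⟩
    obtain ⟨hpm, hc⟩ := mem_kerSet.1 hμ
    exact ⟨(isPM_map_iff eΛ).2 hpm, (onePI_map_iff eΛ eV hown A U a e μ).2 hc⟩

/-- **Relabelling invariance of `𝒜`** (vertices and legs relabelled injectively, weights carried along).
[cite: Balaban1983Higgs3, (1.21) p.416] -/
theorem ampSum_map (hw : ∀ P : Finset Λ, w' (P.map eΛ) = w P) (U : Finset V) (a e : Λ) :
    ampSum own' (A.map eΛ) w' (U.map eV) (eΛ a) (eΛ e) = ampSum own A w U a e := by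
  rw [ampSum, ampSet_map eΛ eV hown, sum_map, ampSum]
  refine sum_congr rfl fun μ _ => ?_
  rw [RelEmbedding.coe_toEmbedding, mapEmbedding_apply, prod_map]
  exact prod_congr rfl fun P _ => by rw [RelEmbedding.coe_toEmbedding, mapEmbedding_apply, hw]

/-- **Relabelling invariance of `K`**. [cite: Balaban1983Higgs3, (1.21) p.416] -/
theorem kerSum_map (hw : ∀ P : Finset Λ, w' (P.map eΛ) = w P) (U : Finset V) (a e : Λ) :
    kerSum own' (A.map eΛ) w' (U.map eV) (eΛ a) (eΛ e) = kerSum own A w U a e := by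
  rw [kerSum, kerSet_map eΛ eV hown, sum_map, kerSum]
  refine sum_congr rfl fun μ _ => ?_
  rw [RelEmbedding.coe_toEmbedding, mapEmbedding_apply, prod_map]
  exact prod_congr rfl fun P _ => by rw [RelEmbedding.coe_toEmbedding, mapEmbedding_apply, hw]

end Transport

/-! ## §4 Matrix form: positions of legs, the propagator between positions, and the last-block recursion for matrices -/

section PosMat

variable {R : Type*} [CommRing R] {S : Type*} [Fintype S] [DecidableEq S] (pos : Λ → S)

/-- A vector of leg quantities summed by position: `posVec L g q = Σ_{e ∈ L, pos e = q} g e`. [cite: Balaban1983Higgs3, (1.21) p.416] -/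
def posVec (L : Finset Λ) (g : Λ → R) (q : S) : R := ∑ e ∈ L, if pos e = q then g e else 0

/-- A matrix of leg quantities summed by the position of the first leg: `posMat L F p q = Σ_{a ∈ L, pos a = p} F a q`.
[cite: Balaban1983Higgs3, (1.21) p.416] -/
def posMat (L : Finset Λ) (F : Λ → S → R) : Matrix S S R := fun p q => ∑ a ∈ L, if pos a = p then F a q else 0

variable {pos}

omit [DecidableEq Λ] in
/-- kernel: a sum against the indicator of a position evaluates at that position. [folklore] [cite: Balaban1983Higgs3, (1.21) p.416] -/
theorem sum_ite_pos_eq (l : Λ) (g : S → R) : ∑ r, (if pos l = r then g r else 0) = g (pos l) := by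
  rw [sum_ite_eq]; simp

omit [DecidableEq Λ] in
/-- kernel: `(posMat L F · C)(p, s) = Σ_{a ∈ L at p} Σ_r F a r · C r s`. [cite: Balaban1983Higgs3, (1.21) p.416] -/
theorem posMat_mul_apply (L : Finset Λ) (F : Λ → S → R) (C : Matrix S S R) (p s : S) :
    (posMat pos L F * C) p s = ∑ a ∈ L, if pos a = p then ∑ r, F a r * C r s else 0 := by
  simp only [Matrix.mul_apply, posMat, sum_mul]
  rw [sum_comm]
  refine sum_congr rfl fun a _ => ?_
  split_ifs <;> simp

omit [DecidableEq Λ] in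
/-- kernel: `Σ_r posVec M g r · C r s = Σ_{a₂ ∈ M} g a₂ · C(pos a₂, s)`. [cite: Balaban1983Higgs3, (1.21) p.416] -/
theorem sum_posVec_mul (M : Finset Λ) (g : Λ → R) (C : Matrix S S R) (s : S) :
    ∑ r, posVec pos M g r * C r s = ∑ a₂ ∈ M, g a₂ * C (pos a₂) s := by
  simp only [posVec, sum_mul]
  rw [sum_comm]
  refine sum_congr rfl fun a₂ _ => ?_
  rw [show (fun r => (if pos a₂ = r then g a₂ else 0) * C r s) = fun r => if pos a₂ = r then g a₂ * C r s else 0 from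
    funext fun r => by split_ifs <;> simp]
  exact sum_ite_pos_eq a₂ _

omit [DecidableEq Λ] in
/-- kernel: `(X · posMat L G)(p, q) = Σ_{e₁ ∈ L} X p (pos e₁) · G e₁ q`. [cite: Balaban1983Higgs3, (1.21) p.416] -/
theorem mul_posMat_apply (X : Matrix S S R) (L : Finset Λ) (G : Λ → S → R) (p q : S) :
    (X * posMat pos L G) p q = ∑ e₁ ∈ L, X p (pos e₁) * G e₁ q := by
  simp only [Matrix.mul_apply, posMat, mul_sum]
  rw [sum_comm]
  refine sum_congr rfl fun e₁ _ => ?_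
  rw [show (fun s => X p s * if pos e₁ = s then G e₁ q else 0) = fun s => if pos e₁ = s then X p s * G e₁ q else 0 from
    funext fun s => by split_ifs <;> simp]
  exact sum_ite_pos_eq e₁ _

omit [DecidableEq Λ] in
/-- **The product `posMat · C · posMat` evaluated**: positions are summed out against the indicators,
`(M₁ C M₂)(p, q) = Σ_{a ∈ L₁ at p} Σ_{a₂ ∈ M a} f a a₂ · Σ_{e₁ ∈ L₂} C(pos a₂, pos e₁) · G e₁ q`. [cite: Balaban1983Higgs3, (1.21) p.416] -/
theorem posMat_mul_mul_posMat (C : Matrix S S R) (L₁ L₂ : Finset Λ) (M : Λ → Finset Λ) (f : Λ → Λ → R) (G : Λ → S → R)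
    (p q : S) :
    (posMat pos L₁ (fun a => posVec pos (M a) (f a)) * C * posMat pos L₂ G) p q
      = ∑ a ∈ L₁, if pos a = p then ∑ a₂ ∈ M a, f a a₂ * ∑ e₁ ∈ L₂, C (pos a₂) (pos e₁) * G e₁ q else 0 := by
  rw [mul_posMat_apply]
  simp only [posMat_mul_apply, sum_posVec_mul, sum_mul]
  rw [sum_comm]
  refine sum_congr rfl fun a _ => ?_
  split_ifs with hp
  · simp only [sum_mul, mul_sum]
    rw [sum_comm]
    refine sum_congr rfl fun a₂ _ => sum_congr rfl fun e₁ _ => ?_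
    ring
  · simp

end PosMat

section MatrixForm

variable (own : Λ → V) (A : Finset Λ) {R : Type*} [CommRing R] (w : Finset Λ → R)
variable {S : Type*} [Fintype S] [DecidableEq S] (pos : Λ → S)

/-- **The amputated connected two-point MATRIX of the vertex set `U`**: `𝒜_U(p, q) = Σ_{a at p} Σ_{e ≠ a at q} 𝒜_U(a, e)`
(labelled connected two-point graphs on the vertices `U`, entry leg at position `p`, exit leg at position `q`, external
propagators stripped). [cite: Balaban1983Higgs3, (1.21) p.416] -/
def ampMat (U : Finset V) : Matrix S S R :=
  posMat pos (legsOf own A U) fun a => posVec pos ((legsOf own A U).erase a) fun e => ampSum own A w U a e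

/-- **The amputated 1PI MATRIX (self-energy insertion) of the vertex set `U`**: `K_U(p, q) = Σ_{a at p} Σ_{e ≠ a at q} K_U(a, e)`
— print's `−δm² + Σ^ε + …` restricted to the labelled 1PI graphs on the vertices `U`. [cite: Balaban1983Higgs3, (1.21) p.416] -/
def kerMat (U : Finset V) : Matrix S S R :=
  posMat pos (legsOf own A U) fun a => posVec pos ((legsOf own A U).erase a) fun e => kerSum own A w U a e

variable {own A w pos} {C : Matrix S S R}

omit [Fintype S] in
/-- **Row recursion**: for an entry leg `a` of `U`,
`𝒜_U(a; q) = K_U(a; q) + Σ_{B ⊆ U, own a ∉ B} Σ_{a₂ ∈ L_{U∖B}∖{a}} 𝒜_{U∖B}(a, a₂) · Σ_{e₁ ∈ L_B} C(pos a₂, pos e₁) · K_B(e₁; q)`.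
[cite: Balaban1983Higgs3, (1.21) p.416] -/
theorem rowA_eq (hw : ∀ l l', l ≠ l' → w {l, l'} = C (pos l) (pos l')) {U : Finset V}
    (hdeg : ∀ v ∈ U, Even (A.filter fun l => own l = v).card) {a : Λ} (ha : a ∈ legsOf own A U) (q : S) :
    posVec pos ((legsOf own A U).erase a) (fun e => ampSum own A w U a e) q
      = posVec pos ((legsOf own A U).erase a) (fun e => kerSum own A w U a e) q +
      ∑ B ∈ U.powerset.filter (fun B => own a ∉ B), ∑ a₂ ∈ (legsOf own A (U \ B)).erase a,
        ampSum own A w (U \ B) a a₂ * ∑ e₁ ∈ legsOf own A B,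
          C (pos a₂) (pos e₁) * posVec pos ((legsOf own A B).erase e₁) (fun e => kerSum own A w B e₁ e) q := by
  -- expand every `𝒜_U(a, e)` by the last-block recursion
  have step1 : posVec pos ((legsOf own A U).erase a) (fun e => ampSum own A w U a e) q
      = posVec pos ((legsOf own A U).erase a) (fun e => kerSum own A w U a e) q +
      ∑ e ∈ (legsOf own A U).erase a, ∑ B ∈ U.powerset.filter (fun B => own e ∈ B ∧ own a ∉ B),
        ∑ a₂ ∈ (legsOf own A (U \ B)).erase a, ∑ e₁ ∈ (legsOf own A B).erase e,
          if pos e = q then ampSum own A w (U \ B) a a₂ * w {a₂, e₁} * kerSum own A w B e₁ e else 0 := by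
    rw [posVec, posVec, ← sum_add_distrib]
    refine sum_congr rfl fun e he => ?_
    obtain ⟨hea, he⟩ := mem_erase.1 he
    by_cases hq : pos e = q
    · simp only [if_pos hq]
      exact ampSum_eq_kerSum_add_last w hdeg ha he (Ne.symm hea)
    · simp only [if_neg hq, sum_const_zero, add_zero]
  rw [step1]
  congr 1
  -- exchange `Σ_e Σ_B` into `Σ_B Σ_{e ∈ L_B}`
  rw [sum_comm' (t' := U.powerset.filter fun B => own a ∉ B) (s' := fun B => legsOf own A B)]
  swap
  · intro e B
    simp only [mem_erase, mem_filter, mem_powerset, mem_legsOf]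
    constructor
    · rintro ⟨⟨-, heA, -⟩, hBU, heB, haB⟩
      exact ⟨⟨heA, heB⟩, hBU, haB⟩
    · rintro ⟨⟨heA, heB⟩, hBU, haB⟩
      exact ⟨⟨fun h => haB (h ▸ heB), heA, hBU heB⟩, hBU, heB, haB⟩
  refine sum_congr rfl fun B _ => ?_
  -- inside a block: `Σ_{e ∈ L_B} Σ_{a₂} Σ_{e₁ ≠ e}` ↦ `Σ_{a₂} Σ_{e₁ ∈ L_B} Σ_{e ≠ e₁}`
  rw [sum_comm]
  refine sum_congr rfl fun a₂ ha₂ => ?_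
  rw [sum_comm' (t' := legsOf own A B) (s' := fun e₁ => (legsOf own A B).erase e₁)]
  swap
  · intro e e₁
    simp only [mem_erase]
    constructor
    · rintro ⟨he, hne, he₁⟩; exact ⟨⟨Ne.symm hne, he⟩, he₁⟩
    · rintro ⟨⟨hne, he⟩, he₁⟩; exact ⟨he, Ne.symm hne, he₁⟩
  rw [mul_sum]
  refine sum_congr rfl fun e₁ he₁ => ?_
  rw [posVec, mul_sum, mul_sum]
  refine sum_congr rfl fun e _ => ?_
  have hne : a₂ ≠ e₁ := fun h =>
    disjoint_left.1 (legs_disjoint own A U B) he₁ (h ▸ (mem_erase.1 ha₂).2)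
  rw [hw a₂ e₁ hne]
  split_ifs <;> ring

/-- **THE LAST-BLOCK RECURSION IN MATRIX FORM**: `𝒜_U = K_U + Σ_{B ⊆ U} 𝒜_{U∖B} · C · K_B` (the empty and the full block
contribute `0`: no legs on one side). [cite: Balaban1983Higgs3, (1.21) p.416] -/
theorem ampMat_eq (hw : ∀ l l', l ≠ l' → w {l, l'} = C (pos l) (pos l')) {U : Finset V}
    (hdeg : ∀ v ∈ U, Even (A.filter fun l => own l = v).card) :
    ampMat own A w pos U = kerMat own A w pos U + ∑ B ∈ U.powerset, ampMat own A w pos (U \ B) * C * kerMat own A w pos B := by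
  ext p q
  rw [Matrix.add_apply, Matrix.sum_apply]
  simp only [ampMat, kerMat, posMat_mul_mul_posMat]
  rw [posMat, posMat]
  -- expand the rows
  have step1 : ∑ a ∈ legsOf own A U, (if pos a = p then
        posVec pos ((legsOf own A U).erase a) (fun e => ampSum own A w U a e) q else 0)
      = ∑ a ∈ legsOf own A U, (if pos a = p then
        posVec pos ((legsOf own A U).erase a) (fun e => kerSum own A w U a e) q else 0) +
        ∑ a ∈ legsOf own A U, ∑ B ∈ U.powerset.filter (fun B => own a ∉ B),
          if pos a = p then ∑ a₂ ∈ (legsOf own A (U \ B)).erase a,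
            ampSum own A w (U \ B) a a₂ * ∑ e₁ ∈ legsOf own A B,
              C (pos a₂) (pos e₁) * posVec pos ((legsOf own A B).erase e₁) (fun e => kerSum own A w B e₁ e) q else 0 := by
    rw [← sum_add_distrib]
    refine sum_congr rfl fun a ha => ?_
    by_cases hp : pos a = p
    · simp only [if_pos hp]
      exact rowA_eq hw hdeg ha q
    · simp only [if_neg hp, sum_const_zero, add_zero]
  rw [step1]
  congr 1
  -- exchange `Σ_a Σ_{B ∌ own a}` into `Σ_B Σ_{a ∈ L_{U∖B}}`
  rw [sum_comm' (t' := U.powerset) (s' := fun B => legsOf own A (U \ B))]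
  intro a B
  simp only [mem_filter, mem_powerset, mem_legsOf, mem_sdiff]
  tauto

omit [Fintype S] in
/-- **Locality of the matrices**: `𝒜_U` depends only on the active legs owned in `U`, their positions and pair weights.
[cite: Balaban1983Higgs3, (1.21) p.416] -/
theorem ampMat_congr {A' : Finset Λ} {w' : Finset Λ → R} {pos' : Λ → S} {U : Finset V}
    (hA : ∀ l, own l ∈ U → (l ∈ A ↔ l ∈ A')) (hw : ∀ P, P ⊆ legsOf own A U → w P = w' P)
    (hpos : ∀ l ∈ legsOf own A U, pos l = pos' l) :
    ampMat own A w pos U = ampMat own A' w' pos' U := by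
  ext p q
  simp only [ampMat, posMat, posVec, ← legsOf_congr hA Subset.rfl]
  refine sum_congr rfl fun a ha => ?_
  rw [hpos a ha]
  split_ifs
  · refine sum_congr rfl fun e he => ?_
    rw [hpos e (mem_of_mem_erase he), ampSum_congr hA hw]
  · rfl

omit [Fintype S] in
/-- **Locality of `K_U`**. [cite: Balaban1983Higgs3, (1.21) p.416] -/
theorem kerMat_congr {A' : Finset Λ} {w' : Finset Λ → R} {pos' : Λ → S} {U : Finset V}
    (hA : ∀ l, own l ∈ U → (l ∈ A ↔ l ∈ A')) (hw : ∀ P, P ⊆ legsOf own A U → w P = w' P)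
    (hpos : ∀ l ∈ legsOf own A U, pos l = pos' l) :
    kerMat own A w pos U = kerMat own A' w' pos' U := by
  ext p q
  simp only [kerMat, posMat, posVec, ← legsOf_congr hA Subset.rfl]
  refine sum_congr rfl fun a ha => ?_
  rw [hpos a ha]
  split_ifs
  · refine sum_congr rfl fun e he => ?_
    rw [hpos e (mem_of_mem_erase he), kerSum_congr hA hw]
  · rfl

omit [Fintype S] in
/-- **Relabelling invariance of the matrices**. [cite: Balaban1983Higgs3, (1.21) p.416] -/
theorem ampMat_map {Λ' : Type*} [DecidableEq Λ'] {V' : Type*} [DecidableEq V'] {own' : Λ' → V'} (eΛ : Λ ↪ Λ') (eV : V ↪ V')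
    (hown : ∀ l, own' (eΛ l) = eV (own l)) {w' : Finset Λ' → R} (hw : ∀ P : Finset Λ, w' (P.map eΛ) = w P)
    {pos' : Λ' → S} (hpos : ∀ l, pos' (eΛ l) = pos l) (U : Finset V) :
    ampMat own' (A.map eΛ) w' pos' (U.map eV) = ampMat own A w pos U := by
  ext p q
  simp only [ampMat, posMat, posVec, legsOf_map eΛ eV hown, sum_map, hpos]
  refine sum_congr rfl fun a _ => ?_
  split_ifs
  · rw [← map_erase, sum_map]   -- `Finset.map_erase`
    exact sum_congr rfl fun e _ => by rw [hpos, ampSum_map eΛ eV hown A hw]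
  · rfl

omit [Fintype S] in
/-- **Relabelling invariance of `K_U`**. [cite: Balaban1983Higgs3, (1.21) p.416] -/
theorem kerMat_map {Λ' : Type*} [DecidableEq Λ'] {V' : Type*} [DecidableEq V'] {own' : Λ' → V'} (eΛ : Λ ↪ Λ') (eV : V ↪ V')
    (hown : ∀ l, own' (eΛ l) = eV (own l)) {w' : Finset Λ' → R} (hw : ∀ P : Finset Λ, w' (P.map eΛ) = w P)
    {pos' : Λ' → S} (hpos : ∀ l, pos' (eΛ l) = pos l) (U : Finset V) :
    kerMat own' (A.map eΛ) w' pos' (U.map eV) = kerMat own A w pos U := by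
  ext p q
  simp only [kerMat, posMat, posVec, legsOf_map eΛ eV hown, sum_map, hpos]
  refine sum_congr rfl fun a _ => ?_
  split_ifs
  · rw [← map_erase, sum_map]
    exact sum_congr rfl fun e _ => by rw [hpos, kerSum_map eΛ eV hown A hw]
  · rfl

end MatrixForm

/-! ## §5 Pair weights from a propagator; colourings of the vertices; the colour-summed recursion -/

section PairWeight

variable {R : Type*} [CommRing R] {S : Type*} (C : Matrix S S R) (pos : Λ → S)

open scoped Classical in
/-- The pair weight `w{l, l′} = C(pos l, pos l′)` of a pair of legs (0 on blocks that are not pairs): «each pair is replaced by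
the corresponding propagator». [cite: Balaban1983Higgs3, p.414] -/
noncomputable def pw (P : Finset Λ) : R :=
  if h : ∃ x y : Λ, x ≠ y ∧ P = {x, y} then C (pos h.choose) (pos h.choose_spec.choose) else 0

variable {C pos}

/-- kernel: the pair weight of `P` depends on the positions of the legs of `P` only. [cite: Balaban1983Higgs3, p.414] -/
theorem pw_congr {pos' : Λ → S} {P : Finset Λ} (h : ∀ l ∈ P, pos l = pos' l) : pw C pos P = pw C pos' P := by
  classical
  by_cases hc : ∃ x y : Λ, x ≠ y ∧ P = {x, y}
  · -- name the chosen legs to avoid dependent rewriting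
    suffices key : ∀ x₀ y₀ : Λ, P = {x₀, y₀} → C (pos x₀) (pos y₀) = C (pos' x₀) (pos' y₀) by
      rw [pw, pw, dif_pos hc, dif_pos hc]
      exact key _ _ hc.choose_spec.choose_spec.2
    intro x₀ y₀ hP
    have hx : x₀ ∈ P := by rw [hP]; exact mem_insert_self _ _
    have hy : y₀ ∈ P := by rw [hP]; exact mem_insert_of_mem (mem_singleton_self _)
    rw [h _ hx, h _ hy]
  · rw [pw, pw, dif_neg hc, dif_neg hc]

/-- kernel: on a pair, for a SYMMETRIC propagator. [cite: Balaban1983Higgs3, p.414] -/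
theorem pw_pair (hC : C.IsSymm) {l l' : Λ} (hne : l ≠ l') : pw C pos {l, l'} = C (pos l) (pos l') := by
  classical
  have h : ∃ x y : Λ, x ≠ y ∧ ({l, l'} : Finset Λ) = {x, y} := ⟨l, l', hne, rfl⟩
  have key : ∀ x₀ y₀ : Λ, ({l, l'} : Finset Λ) = {x₀, y₀} → C (pos x₀) (pos y₀) = C (pos l) (pos l') := by
    intro x₀ y₀ hP
    have hP' := congrArg (fun s : Finset Λ => (s : Set Λ)) hP
    simp only [coe_pair] at hP'
    rcases Set.pair_eq_pair_iff.1 hP' with ⟨h1, h2⟩ | ⟨h1, h2⟩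
    · rw [h1, h2]
    · rw [h1, h2]; exact hC.apply _ _
  rw [pw, dif_pos h]
  exact key _ _ h.choose_spec.choose_spec.2

/-- kernel: blocks that are not pairs weigh `0`. [cite: Balaban1983Higgs3, p.414] -/
theorem pw_of_card_ne_two {P : Finset Λ} (hP : P.card ≠ 2) : pw C pos P = 0 := by
  classical
  rw [pw, dif_neg]
  rintro ⟨x, y, hxy, rfl⟩
  exact hP (card_pair hxy)

/-- kernel: pair weights transport along a relabelling preserving positions. [cite: Balaban1983Higgs3, p.414] -/
theorem pw_map (hC : C.IsSymm) {Λ' : Type*} [DecidableEq Λ'] (e : Λ ↪ Λ') {pos' : Λ' → S} (hpos : ∀ l, pos' (e l) = pos l)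
    (P : Finset Λ) : pw C pos' (P.map e) = pw C pos P := by
  by_cases h : ∃ x y : Λ, x ≠ y ∧ P = {x, y}
  · obtain ⟨x, y, hxy, rfl⟩ := h
    rw [map_insert, map_singleton, pw_pair hC (e.injective.ne hxy), pw_pair hC hxy, hpos, hpos]
  · have hP : P.card ≠ 2 := fun h2 => h (card_eq_two.1 h2)
    rw [pw_of_card_ne_two hP, pw_of_card_ne_two (by rwa [card_map])]

end PairWeight

section Colour

variable {W : Type*} [DecidableEq W] {κ : Type*} {S : Type*} {R : Type*} {D : ℕ}

/-- VERTEX DATA of a Gaussian perturbation expansion: the vertex colours `Kv` (one colour = one vertex type with its site and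
internal indices, p. 416: «internal indices and vector indices are understood»), a spare colour `c₀` for absent vertices, the
number of legs `deg c ≤ D` of a colour (EVEN for vertex colours), the positions `lpos c i` of its legs, its coefficient `coef c`
(e.g. `−λε^d`, `−½δm²ε^d` of (1.20)). [cite: Balaban1983Higgs3, (1.20) p.416] -/
structure VertexData (κ S R : Type*) (D : ℕ) where
  /-- the vertex colours -/
  Kv : Finset κ
  /-- the colour of an absent vertex -/
  c₀ : κ
  /-- number of legs of a colour -/
  deg : κ → ℕ
  /-- at most `D` -/
  deg_le : ∀ c, deg c ≤ D
  /-- vertices have an even number of legs -/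
  deg_even : ∀ c ∈ Kv, Even (deg c)
  /-- positions (site, internal index) of the legs of a colour -/
  lpos : κ → Fin D → S
  /-- the coefficient of a colour -/
  coef : κ → R

namespace VertexData

variable (𝓥 : VertexData κ S R D)

/-- The ACTIVE legs of a colouring `z` of the vertices: the legs `(v, i)` with `i < deg (z v)`. [cite: Balaban1983Higgs3, (1.21) p.416] -/
def act [Fintype W] (z : W → κ) : Finset (W × Fin D) := univ.filter fun l => (l.2 : ℕ) < 𝓥.deg (z l.1)

/-- The positions of the legs of a colouring. [cite: Balaban1983Higgs3, (1.21) p.416] -/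
def lposOf (z : W → κ) (l : W × Fin D) : S := 𝓥.lpos (z l.1) l.2

/-- The COLOURINGS of the vertex set `U`: vertex colours on `U`, the spare colour elsewhere. [cite: Balaban1983Higgs3, (1.21) p.416] -/
def col [Fintype W] [DecidableEq κ] (U : Finset W) : Finset (W → κ) :=
  Fintype.piFinset fun v => if v ∈ U then 𝓥.Kv else {𝓥.c₀}

/-- The coefficient of a colouring of `U`: the product of the coefficients of its vertices. [cite: Balaban1983Higgs3, (1.21) p.416] -/
def coefOf [CommRing R] (U : Finset W) (z : W → κ) : R := ∏ v ∈ U, 𝓥.coef (z v)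

/-- MERGING two colourings along a block `B`: `z₁` on `B`, `z₂` elsewhere. [cite: Balaban1983Higgs3, (1.21) p.416] -/
def merge (B : Finset W) (z₁ z₂ : W → κ) : W → κ := fun v => if v ∈ B then z₁ v else z₂ v

/-- RESTRICTING a colouring to a block (spare colour elsewhere). [cite: Balaban1983Higgs3, (1.21) p.416] -/
def restrict (B : Finset W) (z : W → κ) : W → κ := fun v => if v ∈ B then z v else 𝓥.c₀

variable {𝓥}

/-- [cite: Balaban1983Higgs3, (1.21) p.416] -/
theorem mem_col [Fintype W] [DecidableEq κ] {U : Finset W} {z : W → κ} :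
    z ∈ 𝓥.col U ↔ (∀ v ∈ U, z v ∈ 𝓥.Kv) ∧ ∀ v ∉ U, z v = 𝓥.c₀ := by
  rw [col, Fintype.mem_piFinset]
  constructor
  · intro h
    refine ⟨fun v hv => ?_, fun v hv => ?_⟩
    · have := h v; rwa [if_pos hv] at this
    · have := h v; rwa [if_neg hv, mem_singleton] at this
  · rintro ⟨h1, h2⟩ v
    by_cases hv : v ∈ U
    · rw [if_pos hv]; exact h1 v hv
    · rw [if_neg hv, mem_singleton]; exact h2 v hv

/-- kernel: the active legs of a vertex are `deg` many. [cite: Balaban1983Higgs3, (1.21) p.416] -/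
theorem card_act_fiber [Fintype W] (z : W → κ) (v : W) : ((𝓥.act z).filter fun l => l.1 = v).card = 𝓥.deg (z v) := by
  have : ((𝓥.act z).filter fun l => l.1 = v) = (univ.filter fun i : Fin D => (i : ℕ) < 𝓥.deg (z v)).map
      ⟨fun i => (v, i), fun i j h => (Prod.mk.inj h).2⟩ := by
    ext ⟨v', i⟩
    simp only [act, mem_filter, mem_univ, true_and, mem_map, Function.Embedding.coeFn_mk, Prod.mk.injEq]
    constructor
    · rintro ⟨h1, rfl⟩; exact ⟨i, h1, rfl, rfl⟩
    · rintro ⟨j, hj, rfl, rfl⟩; exact ⟨hj, rfl⟩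
  rw [this, card_map, Fin.card_filter_val_lt, min_eq_right (𝓥.deg_le _)]

/-- kernel: a colouring of `U` has EVEN degrees on `U`. [cite: Balaban1983Higgs3, (1.21) p.416] -/
theorem even_deg_of_mem_col [Fintype W] [DecidableEq κ] {U : Finset W} {z : W → κ} (hz : z ∈ 𝓥.col U) :
    ∀ v ∈ U, Even ((𝓥.act z).filter fun l => l.1 = v).card := fun v hv => by
  rw [card_act_fiber]
  exact 𝓥.deg_even _ ((mem_col.1 hz).1 v hv)

/-- kernel: merging colourings of `B` and of `U ∖ B` gives a colouring of `U`. [cite: Balaban1983Higgs3, (1.21) p.416] -/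
theorem merge_mem_col [Fintype W] [DecidableEq κ] {U B : Finset W} (hBU : B ⊆ U) {z₁ z₂ : W → κ} (h₁ : z₁ ∈ 𝓥.col B)
    (h₂ : z₂ ∈ 𝓥.col (U \ B)) : merge B z₁ z₂ ∈ 𝓥.col U := by
  rw [mem_col] at h₁ h₂ ⊢
  refine ⟨fun v hv => ?_, fun v hv => ?_⟩
  · unfold merge; split_ifs with hvB
    · exact h₁.1 v hvB
    · exact h₂.1 v (mem_sdiff.2 ⟨hv, hvB⟩)
  · unfold merge; split_ifs with hvB
    · exact absurd (hBU hvB) hv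
    · exact h₂.2 v fun h => hv (mem_sdiff.1 h).1

/-- kernel: restricting a colouring of `U` to `B ⊆ U` gives a colouring of `B`. [cite: Balaban1983Higgs3, (1.21) p.416] -/
theorem restrict_mem_col [Fintype W] [DecidableEq κ] {U B : Finset W} (hBU : B ⊆ U) {z : W → κ} (hz : z ∈ 𝓥.col U) :
    𝓥.restrict B z ∈ 𝓥.col B := by
  rw [mem_col] at hz ⊢
  refine ⟨fun v hv => ?_, fun v hv => ?_⟩
  · unfold restrict; rw [if_pos hv]; exact hz.1 v (hBU hv)
  · unfold restrict; rw [if_neg hv]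

variable [Fintype W] [DecidableEq κ] [Fintype S] [DecidableEq S] [CommRing R] (𝓥) (C : Matrix S S R)

/-- The per-colouring amputated connected matrix `𝒜_z(U)`. [cite: Balaban1983Higgs3, (1.21) p.416] -/
noncomputable def ampMatZ (z : W → κ) (U : Finset W) : Matrix S S R :=
  ampMat Prod.fst (𝓥.act z) (pw C (𝓥.lposOf z)) (𝓥.lposOf z) U

/-- The per-colouring amputated 1PI matrix `K_z(U)`. [cite: Balaban1983Higgs3, (1.21) p.416] -/
noncomputable def kerMatZ (z : W → κ) (U : Finset W) : Matrix S S R :=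
  kerMat Prod.fst (𝓥.act z) (pw C (𝓥.lposOf z)) (𝓥.lposOf z) U

/-- **`𝔸(U)`: the COLOUR-SUMMED amputated connected two-point matrix of the vertex set `U`** — the sum over the colourings `z`
of `U` of `(Π_{v∈U} coef z_v) · 𝒜_z(U)`: all labelled connected two-point graphs on the vertices `U`, every vertex summed over
its types/sites/indices, amputated. [cite: Balaban1983Higgs3, (1.21) p.416] -/
noncomputable def AMat (U : Finset W) : Matrix S S R := ∑ z ∈ 𝓥.col U, 𝓥.coefOf U z • 𝓥.ampMatZ C z U

/-- **`𝕂(U)`: the COLOUR-SUMMED amputated 1PI matrix of the vertex set `U`** (the labelled self-energy insertion on `U`).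
[cite: Balaban1983Higgs3, (1.21) p.416] -/
noncomputable def KMat (U : Finset W) : Matrix S S R := ∑ z ∈ 𝓥.col U, 𝓥.coefOf U z • 𝓥.kerMatZ C z U

variable {𝓥 C}

omit [DecidableEq κ] [Fintype S] in
/-- kernel: `𝒜_z(B)` depends only on the colours of the block `B`. [cite: Balaban1983Higgs3, (1.21) p.416] -/
theorem ampMatZ_congr {B : Finset W} {z z' : W → κ} (h : ∀ v ∈ B, z v = z' v) : 𝓥.ampMatZ C z B = 𝓥.ampMatZ C z' B := by
  have hA : ∀ l : W × Fin D, l.1 ∈ B → (l ∈ 𝓥.act z ↔ l ∈ 𝓥.act z') := fun l hl => by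
    simp only [act, mem_filter, mem_univ, true_and, h l.1 hl]
  have hpos : ∀ l ∈ legsOf Prod.fst (𝓥.act z) B, 𝓥.lposOf z l = 𝓥.lposOf z' l := fun l hl => by
    simp only [lposOf, h l.1 ((mem_legsOf Prod.fst (𝓥.act z)).1 hl).2]
  exact ampMat_congr hA (fun P hP => pw_congr fun l hl => hpos l (hP hl)) hpos

omit [DecidableEq κ] [Fintype S] in
/-- kernel: `K_z(B)` depends only on the colours of the block `B`. [cite: Balaban1983Higgs3, (1.21) p.416] -/
theorem kerMatZ_congr {B : Finset W} {z z' : W → κ} (h : ∀ v ∈ B, z v = z' v) : 𝓥.kerMatZ C z B = 𝓥.kerMatZ C z' B := by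
  have hA : ∀ l : W × Fin D, l.1 ∈ B → (l ∈ 𝓥.act z ↔ l ∈ 𝓥.act z') := fun l hl => by
    simp only [act, mem_filter, mem_univ, true_and, h l.1 hl]
  have hpos : ∀ l ∈ legsOf Prod.fst (𝓥.act z) B, 𝓥.lposOf z l = 𝓥.lposOf z' l := fun l hl => by
    simp only [lposOf, h l.1 ((mem_legsOf Prod.fst (𝓥.act z)).1 hl).2]
  exact kerMat_congr hA (fun P hP => pw_congr fun l hl => hpos l (hP hl)) hpos

omit [DecidableEq W] [Fintype W] [DecidableEq κ] [Fintype S] [DecidableEq S] in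
/-- kernel: coefficients depend only on the colours of the block. [cite: Balaban1983Higgs3, (1.21) p.416] -/
theorem coefOf_congr {B : Finset W} {z z' : W → κ} (h : ∀ v ∈ B, z v = z' v) : 𝓥.coefOf B z = 𝓥.coefOf B z' :=
  prod_congr rfl fun v hv => by rw [h v hv]

/-- **Colours of a block and of its complement are independent**: the colour sum of `coef · 𝒜_z(U∖B) · C · K_z(B)` over the
colourings of `U` factorizes as `𝔸(U∖B) · C · 𝕂(B)`. [cite: Balaban1983Higgs3, (1.21) p.416] -/
theorem sum_col_merge {U B : Finset W} (hBU : B ⊆ U) :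
    ∑ z ∈ 𝓥.col U, 𝓥.coefOf U z • (𝓥.ampMatZ C z (U \ B) * C * 𝓥.kerMatZ C z B) = 𝓥.AMat C (U \ B) * C * 𝓥.KMat C B := by
  rw [AMat, KMat, Finset.sum_mul, Finset.sum_mul]
  simp_rw [Finset.mul_sum, smul_mul_assoc, mul_smul_comm, smul_smul]
  rw [← Finset.sum_product']
  refine sum_nbij' (fun z => (𝓥.restrict (U \ B) z, 𝓥.restrict B z)) (fun x => merge B x.2 x.1) ?_ ?_ ?_ ?_ ?_
  · intro z hz
    exact mem_product.2 ⟨𝓥.restrict_mem_col sdiff_subset hz, 𝓥.restrict_mem_col hBU hz⟩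
  · rintro ⟨z₂, z₁⟩ hx
    obtain ⟨h₂, h₁⟩ := mem_product.1 hx
    exact 𝓥.merge_mem_col hBU h₁ h₂
  · intro z hz
    obtain ⟨-, hz0⟩ := mem_col.1 hz
    funext v
    simp only [merge, restrict]
    split_ifs with h1 h2 <;> first | rfl | exact (hz0 v fun hvU => h2 (mem_sdiff.2 ⟨hvU, h1⟩)).symm
  · rintro ⟨z₂, z₁⟩ hx
    obtain ⟨h₂, h₁⟩ := mem_product.1 hx
    obtain ⟨-, h₂0⟩ := mem_col.1 h₂
    obtain ⟨-, h₁0⟩ := mem_col.1 h₁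
    simp only [Prod.mk.injEq]
    constructor
    · funext v
      simp only [merge, restrict]
      split_ifs with h1 h2 <;>
        first | rfl | exact absurd h2 (mem_sdiff.1 h1).2 | exact (h₂0 v h1).symm
    · funext v
      simp only [merge, restrict]
      split_ifs with h1 <;> first | rfl | exact (h₁0 v h1).symm
  · intro z hz
    have hB : ∀ v ∈ B, z v = 𝓥.restrict B z v := fun v hv => by simp [restrict, hv]
    have hC' : ∀ v ∈ U \ B, z v = 𝓥.restrict (U \ B) z v := fun v hv => by simp [restrict, hv]
    rw [ampMatZ_congr hC', kerMatZ_congr hB, coefOf, ← prod_sdiff hBU]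
    rw [show ∏ v ∈ U \ B, 𝓥.coef (z v) = 𝓥.coefOf (U \ B) (𝓥.restrict (U \ B) z) from coefOf_congr hC',
      show ∏ v ∈ B, 𝓥.coef (z v) = 𝓥.coefOf B (𝓥.restrict B z) from coefOf_congr hB]

/-- **THE COLOUR-SUMMED LAST-BLOCK RECURSION**: for a symmetric propagator `C`,
`𝔸(U) = 𝕂(U) + Σ_{B ⊆ U} 𝔸(U ∖ B) · C · 𝕂(B)` — every labelled connected two-point graph on `U` is one-particle
irreducible, or a connected graph on `U ∖ B`, one line `C`, and a LAST 1PI piece on a block `B`; the colours of the two parts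
are independent. [cite: Balaban1983Higgs3, (1.21) p.416] -/
theorem AMat_eq (hC : C.IsSymm) (U : Finset W) :
    𝓥.AMat C U = 𝓥.KMat C U + ∑ B ∈ U.powerset, 𝓥.AMat C (U \ B) * C * 𝓥.KMat C B := by
  -- per colouring
  have hz : ∀ z ∈ 𝓥.col U, 𝓥.ampMatZ C z U = 𝓥.kerMatZ C z U + ∑ B ∈ U.powerset, 𝓥.ampMatZ C z (U \ B) * C * 𝓥.kerMatZ C z B :=
    fun z hz => ampMat_eq (fun l l' hne => pw_pair hC hne) (even_deg_of_mem_col hz)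
  calc 𝓥.AMat C U = ∑ z ∈ 𝓥.col U, 𝓥.coefOf U z • (𝓥.kerMatZ C z U + ∑ B ∈ U.powerset, 𝓥.ampMatZ C z (U \ B) * C * 𝓥.kerMatZ C z B) := by
        rw [AMat]; exact sum_congr rfl fun z hz' => by rw [hz z hz']
    _ = 𝓥.KMat C U + ∑ B ∈ U.powerset, ∑ z ∈ 𝓥.col U, 𝓥.coefOf U z • (𝓥.ampMatZ C z (U \ B) * C * 𝓥.kerMatZ C z B) := by
        simp only [smul_add, smul_sum, sum_add_distrib, KMat]
        rw [sum_comm]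
    _ = _ := by
        congr 1
        refine sum_congr rfl fun B hB => ?_
        exact sum_col_merge (mem_powerset.1 hB)

end VertexData

end Colour

end Literature.MathematicalPhysics.QuantumFieldTheory.Balaban1983to89.B3Eq121LabelledChains
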